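import Summits.CriticalPhenomena.PercolationContinuityZ3.Theorems.PercNearOneGluingNoHeavyLowerTailSahiCTCLadderThreeRowThreeZero
import HarnessLib

/-!
# `NoHeavyLowerTail` (crux stmt-CriticalPhenomena-4575), P3 lane: the family facts of the row `#dbl = 3` of `(L_3)` without the α-edge

Support file (seat `prim-l12-p3`, gen 26; `--supports stmt-CriticalPhenomena-4575`).  Paper proof `prim-l12-p3/ROW3-PROOF-g26.md` §6.
For a family (link at `d ∈ D`) with `Φ = Σ_{y₀} κ₂(d,y₀) − q_d (+ Σ_Q κ₁(d,Q))`: the KEY STEP "the 1-live cubes pay the Q-charges"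
(`phi_pos_fact`: for `τ ≥ 12` and any valid `L₀ ≤ Σκ₂` with `L₀ ≤ τ²`, `Σκ₂ − q + Σκ₁ ≥ L₀ + 2τ − #{Q ⊇ C}`, by MANTEL when the
Q-graph is dense and by the cap `4q ≤ (τ−1)(τ+3)` otherwise), the degree-type bound with the Q-data eliminated when the own C-set is empty
(`phi_zero_fact`: `(2τ−4)(Σκ₂ − q) ≥ L₀(τ−4) + τ(τ−2)`), `Σκ₂ − q ≥ 0` (`phi_nonneg`), and the uniform DEGREE sum
`Σκ₂ ≥ τ + (τ−1)#C − 1` for a nonempty C-set (`sum_kapL2_ge_deg_one`).  Nothing is asserted about the crux.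
-/

namespace Summit.CriticalPhenomena.PercolationContinuityZ3.Theorems.SahiCTCForms

open Finset MvPolynomial SahiCTCGenFun SahiCTCWeightedLYM

variable {α : Type*} [DecidableEq α] [Fintype α]

section RowThreeZeroFacts
variable {𝒳 𝒵 : Finset (Finset α)}

omit [Fintype α] in
/-- Degrees of the Q-graph are at most `τ − 1`. [this work] -/
theorem qdeg_le (m : α →₀ ℕ) (d : α) {v : α} (hv : v ∈ lev m 1) : qdeg 𝒳 𝒵 m d v ≤ #(lev m 1) - 1 := by
  rw [← card_qnbrs_eq m d v, ← card_erase_of_mem hv]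
  exact card_le_card fun u hu => mem_erase.2 ⟨(mem_filter.1 hu).2.1, (mem_filter.1 hu).1⟩

omit [Fintype α] in
/-- `#qset ≤ C(τ,2)`. [this work] -/
theorem card_qset_le_choose (m : α →₀ ℕ) (d : α) : #(qset 𝒳 𝒵 m d) ≤ (#(lev m 1)).choose 2 := by
  unfold qset; exact (card_filter_le _ _).trans (card_powersetCard _ _).le

/-- **Uniform DEGREE sum**: for `x ∈ D∖d` with nonempty C-set, `Σ_{y₀} κ₂(d,y₀) ≥ τ + (τ−1)·#C − 1` (`τ ≥ 2`). [this work] -/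
theorem sum_kapL2_ge_deg_one (h𝒳 : IsUpperSet (𝒳 : Set (Finset α))) (h𝒵 : IsUpperSet (𝒵 : Set (Finset α)))
    (hX3 : ∀ S ∈ 𝒳, 3 ≤ #S) (hZ3 : ∀ S ∈ 𝒵, 3 ≤ #S) {m : α →₀ ℕ} (hD : #(dbl m) = 3) (hτ : 2 ≤ #(lev m 1)) {d : α} (hd : d ∈ dbl m)
    {x : α} (hx : x ∈ (dbl m).erase d) (hC : 1 ≤ #(csetL2 𝒳 𝒵 m d x)) :
    (#(lev m 1) : ℤ) + ((#(lev m 1) : ℤ) - 1) * #(csetL2 𝒳 𝒵 m d x) - 1 ≤ ∑ y₀ ∈ lev m 1, kapL2 𝒳 𝒵 m d y₀ := by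
  by_cases h2 : 2 ≤ #(csetL2 𝒳 𝒵 m d x)
  · have := sum_kapL2_ge_deg h𝒳 h𝒵 hX3 hZ3 hD hτ hd hx h2; linarith
  · have h1 : #(csetL2 𝒳 𝒵 m d x) = 1 := by omega
    obtain ⟨w, hw⟩ := card_eq_one.1 h1
    have hwC : w ∈ csetL2 𝒳 𝒵 m d x := by rw [hw]; exact mem_singleton_self w
    obtain ⟨hwT, hwX, hwZ⟩ := mem_csetL2.1 hwC
    have h0 : ∀ y₀, (0 : ℤ) ≤ kapL2 𝒳 𝒵 m d y₀ := fun y₀ => by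
      unfold kapL2; exact kap_nonneg h𝒳 h𝒵 _ _ (by
        rw [disjoint_singleton_left, mem_union, not_or]; exact ⟨notMem_erase d _, fun h =>
          disjoint_left.1 (disjoint_dbl_lev_one m) hd (mem_of_mem_erase h)⟩)
    have hper : ∀ y₀ ∈ (lev m 1).erase w, (2 : ℤ) ≤ kapL2 𝒳 𝒵 m d y₀ := fun y₀ hy₀ => by
      have hy₀T := mem_of_mem_erase hy₀
      have h := card_add_one_le_kapL2_of_nbrs h𝒳 h𝒵 hX3 hZ3 hD hd hy₀T hτ (v := x) (mem_union_left _ hx) (S := {w})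
        (fun u hu => by
          rw [mem_singleton.1 hu]
          exact mem_erase.2 ⟨fun h => disjoint_left.1 (disjoint_dbl_lev_one m) (mem_of_mem_erase hx) (h ▸ hwT),
            mem_union_right _ (mem_erase.2 ⟨(ne_of_mem_erase hy₀).symm, hwT⟩)⟩)
        (fun u hu => by rw [mem_singleton.1 hu]; exact ⟨hwX, hwZ⟩) (singleton_nonempty _)
      rw [card_singleton] at h; push_cast at h; linarith
    have hs := sum_le_sum hper
    have hsub := sum_le_sum_of_subset_of_nonneg (erase_subset w (lev m 1)) (fun y₀ _ _ => h0 y₀) (f := fun y₀ => kapL2 𝒳 𝒵 m d y₀)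
    rw [sum_const, nsmul_eq_mul] at hs
    have hcard : (#((lev m 1).erase w) : ℤ) = #(lev m 1) - 1 := by have := card_erase_add_one hwT; omega
    rw [hcard] at hs; rw [h1]; push_cast; linarith

/-- **KEY STEP of the α = 0 half ("the 1-live cubes pay the Q-charges")**: for `τ ≥ 12` and any valid bound `L₀ ≤ Σκ₂(d,·)` with
`L₀ ≤ τ²`, `Σ_{y₀} κ₂(d,y₀) − q_d + Σ_Q κ₁(d,Q) ≥ L₀ + 2τ − #{Q ⊆ T pair : C ⊆ Q}` (`C` the C-set of the pair `D∖d`). [this work] -/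
theorem phi_pos_fact (h𝒳 : IsUpperSet (𝒳 : Set (Finset α))) (h𝒵 : IsUpperSet (𝒵 : Set (Finset α)))
    (hX3 : ∀ S ∈ 𝒳, 3 ≤ #S) (hZ3 : ∀ S ∈ 𝒵, 3 ≤ #S) {m : α →₀ ℕ} (hD : #(dbl m) = 3) (hτ : 12 ≤ #(lev m 1)) {d : α} (hd : d ∈ dbl m)
    {L₀ : ℤ} (hL₀ : L₀ ≤ ∑ y₀ ∈ lev m 1, kapL2 𝒳 𝒵 m d y₀) (hL₀' : L₀ ≤ (#(lev m 1) : ℤ) ^ 2) :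
    L₀ + 2 * #(lev m 1) - #(((lev m 1).powersetCard 2).filter fun Q =>
        ((lev m 1).filter fun y => insert y ((dbl m).erase d) ∈ 𝒳 ∧ insert y ((dbl m).erase d) ∈ 𝒵) ⊆ Q) ≤
      ∑ y₀ ∈ lev m 1, kapL2 𝒳 𝒵 m d y₀ - #(qset 𝒳 𝒵 m d) + ∑ Q ∈ (lev m 1).powersetCard 2, kapL1 𝒳 𝒵 m d Q := by
  have hL1 := sum_kapL1_ge_sub h𝒳 h𝒵 hX3 hZ3 hD hd (𝒳 := 𝒳) (𝒵 := 𝒵)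
  have hq : (#(qset 𝒳 𝒵 m d) : ℤ) ≤ (#(lev m 1)).choose 2 := by exact_mod_cast card_qset_le_choose m d
  have hT2 : 2 * (((#(lev m 1)).choose 2 : ℕ) : ℤ) = (#(lev m 1) : ℤ) ^ 2 - #(lev m 1) := by
    have h2 : (#(lev m 1)).choose 2 * 2 = #(lev m 1) * (#(lev m 1) - 1) := by
      rw [Nat.choose_two_right]; exact Nat.div_mul_cancel (Nat.even_mul_pred_self _).two_dvd
    have h1 : 1 ≤ #(lev m 1) := by omega
    have := congrArg (fun k : ℕ => (k : ℤ)) h2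
    push_cast [Nat.cast_sub h1] at this; linarith
  have hτ' : (12 : ℤ) ≤ #(lev m 1) := by exact_mod_cast hτ
  have hT : (lev m 1).Nonempty := card_pos.1 (by omega)
  obtain ⟨v, hv, hmax⟩ := exists_max_image (lev m 1) (qdeg 𝒳 𝒵 m d) hT
  by_cases hdense : (#(lev m 1) - 1) ^ 2 < 4 * (#(qset 𝒳 𝒵 m d) - qdeg 𝒳 𝒵 m d v)
  · have htri := sum_kapL2_ge_of_dense h𝒳 h𝒵 hX3 hZ3 hD hd hmax hdense
    nlinarith [htri, hL1, hq, hT2]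
  · -- cap: 4 q ≤ (τ−1)² + 4Δ ≤ (τ−1)² + 4(τ−1)
    have hΔ := qdeg_le m d hv (𝒳 := 𝒳) (𝒵 := 𝒵)
    have hcap : 4 * (#(qset 𝒳 𝒵 m d) : ℤ) ≤ ((#(lev m 1) : ℤ) - 1) ^ 2 + 4 * ((#(lev m 1) : ℤ) - 1) := by
      have h1 : 1 ≤ #(lev m 1) := by omega
      have h4 : 4 * #(qset 𝒳 𝒵 m d) ≤ (#(lev m 1) - 1) ^ 2 + 4 * (#(lev m 1) - 1) := by
        push Not at hdense
        have : 4 * (#(qset 𝒳 𝒵 m d) - qdeg 𝒳 𝒵 m d v) ≤ (#(lev m 1) - 1) ^ 2 := hdense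
        omega
      have := congrArg (fun k : ℕ => (k : ℤ)) (Nat.sub_add_cancel h1)
      zify [h1] at h4; exact h4
    nlinarith [hL1, hcap, hT2, hL₀]

/-- **Degree-type family with empty own C-set**: for `τ ≥ 4` and a valid bound `τ − 2 ≤ L₀ ≤ Σκ₂(d,·)`, `L₀ ≤ τ²`,
`(2τ−4)(Σ_{y₀} κ₂(d,y₀) − q_d) ≥ L₀(τ−4) + τ(τ−2)`. [this work] -/
theorem phi_zero_fact (h𝒳 : IsUpperSet (𝒳 : Set (Finset α))) (h𝒵 : IsUpperSet (𝒵 : Set (Finset α)))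
    (hX3 : ∀ S ∈ 𝒳, 3 ≤ #S) (hZ3 : ∀ S ∈ 𝒵, 3 ≤ #S) {m : α →₀ ℕ} (hD : #(dbl m) = 3) (hτ : 4 ≤ #(lev m 1)) {d : α} (hd : d ∈ dbl m)
    {L₀ : ℤ} (hL₀ : L₀ ≤ ∑ y₀ ∈ lev m 1, kapL2 𝒳 𝒵 m d y₀) (hL₀' : L₀ ≤ (#(lev m 1) : ℤ) ^ 2) (hL₀'' : (#(lev m 1) : ℤ) - 2 ≤ L₀) :
    L₀ * ((#(lev m 1) : ℤ) - 4) + #(lev m 1) * ((#(lev m 1) : ℤ) - 2) ≤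
      (2 * (#(lev m 1) : ℤ) - 4) * (∑ y₀ ∈ lev m 1, kapL2 𝒳 𝒵 m d y₀ - #(qset 𝒳 𝒵 m d)) := by
  have hq : (#(qset 𝒳 𝒵 m d) : ℤ) ≤ (#(lev m 1)).choose 2 := by exact_mod_cast card_qset_le_choose m d
  have hT2 : 2 * (((#(lev m 1)).choose 2 : ℕ) : ℤ) = (#(lev m 1) : ℤ) ^ 2 - #(lev m 1) := by
    have h2 : (#(lev m 1)).choose 2 * 2 = #(lev m 1) * (#(lev m 1) - 1) := by
      rw [Nat.choose_two_right]; exact Nat.div_mul_cancel (Nat.even_mul_pred_self _).two_dvd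
    have h1 : 1 ≤ #(lev m 1) := by omega
    have := congrArg (fun k : ℕ => (k : ℤ)) h2
    push_cast [Nat.cast_sub h1] at this; linarith
  have hτ' : (4 : ℤ) ≤ #(lev m 1) := by exact_mod_cast hτ
  have hT : (lev m 1).Nonempty := card_pos.1 (by omega)
  obtain ⟨v, hv, hmax⟩ := exists_max_image (lev m 1) (qdeg 𝒳 𝒵 m d) hT
  by_cases hdense : (#(lev m 1) - 1) ^ 2 < 4 * (#(qset 𝒳 𝒵 m d) - qdeg 𝒳 𝒵 m d v)
  · have htri := sum_kapL2_ge_of_dense h𝒳 h𝒵 hX3 hZ3 hD hd hmax hdense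
    nlinarith [htri, hq, hT2]
  · by_cases hΔ0 : qdeg 𝒳 𝒵 m d v = 0
    · -- no Q-edges at all
      have hq0 : #(qset 𝒳 𝒵 m d) = 0 := by
        have := two_mul_card_qset_le m d hmax (𝒳 := 𝒳) (𝒵 := 𝒵); rw [hΔ0, mul_zero] at this; omega
      rw [hq0]; push_cast; nlinarith [hL₀, hL₀'']
    · have hTd := sum_kapL2_ge_tdeg h𝒳 h𝒵 hX3 hZ3 hD (by omega) hd hv (by omega)
      have h2q : 2 * (#(qset 𝒳 𝒵 m d) : ℤ) ≤ #(lev m 1) * (qdeg 𝒳 𝒵 m d v : ℤ) := by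
        exact_mod_cast two_mul_card_qset_le m d hmax
      -- (2τ−4)(L − q) ≥ (2τ−4)L − (τ−2)τΔ ≥ (2τ−4)L − τ(L − (τ−2)) = L(τ−4) + τ(τ−2)
      have p1 := mul_le_mul_of_nonneg_left h2q (by linarith : (0 : ℤ) ≤ #(lev m 1) - 2)
      have p2 := mul_le_mul_of_nonneg_left hTd (by linarith : (0 : ℤ) ≤ #(lev m 1))
      have p3 := mul_le_mul_of_nonneg_right hL₀ (by linarith : (0 : ℤ) ≤ #(lev m 1) - 4)
      nlinarith [p1, p2, p3]

/-- `Σ_{y₀} κ₂(d,y₀) − q_d ≥ 0` (`τ ≥ 4`). [this work] -/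
theorem phi_nonneg (h𝒳 : IsUpperSet (𝒳 : Set (Finset α))) (h𝒵 : IsUpperSet (𝒵 : Set (Finset α)))
    (hX3 : ∀ S ∈ 𝒳, 3 ≤ #S) (hZ3 : ∀ S ∈ 𝒵, 3 ≤ #S) {m : α →₀ ℕ} (hD : #(dbl m) = 3) (hτ : 4 ≤ #(lev m 1)) {d : α} (hd : d ∈ dbl m) :
    (#(qset 𝒳 𝒵 m d) : ℤ) ≤ ∑ y₀ ∈ lev m 1, kapL2 𝒳 𝒵 m d y₀ := by
  have hT : (lev m 1).Nonempty := card_pos.1 (by omega)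
  obtain ⟨v, hv, hmax⟩ := exists_max_image (lev m 1) (qdeg 𝒳 𝒵 m d) hT
  have h2q : 2 * (#(qset 𝒳 𝒵 m d) : ℤ) ≤ #(lev m 1) * (qdeg 𝒳 𝒵 m d v : ℤ) := by
    exact_mod_cast two_mul_card_qset_le m d hmax
  have h0 : (0 : ℤ) ≤ ∑ y₀ ∈ lev m 1, kapL2 𝒳 𝒵 m d y₀ := sum_nonneg fun y₀ _ => by
    unfold kapL2; exact kap_nonneg h𝒳 h𝒵 _ _ (by
      rw [disjoint_singleton_left, mem_union, not_or]; exact ⟨notMem_erase d _, fun h =>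
        disjoint_left.1 (disjoint_dbl_lev_one m) hd (mem_of_mem_erase h)⟩)
  by_cases hΔ0 : qdeg 𝒳 𝒵 m d v = 0
  · have hq0 : #(qset 𝒳 𝒵 m d) = 0 := by
      have := two_mul_card_qset_le m d hmax (𝒳 := 𝒳) (𝒵 := 𝒵); rw [hΔ0, mul_zero] at this; omega
    rw [hq0]; exact_mod_cast h0
  · have hTd := sum_kapL2_ge_tdeg h𝒳 h𝒵 hX3 hZ3 hD (by omega) hd hv (by omega)
    have hτ' : (4 : ℤ) ≤ #(lev m 1) := by exact_mod_cast hτ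
    have hq0' : (0 : ℤ) ≤ qdeg 𝒳 𝒵 m d v := Nat.cast_nonneg _
    nlinarith [hTd, h2q]

end RowThreeZeroFacts

end Summit.CriticalPhenomena.PercolationContinuityZ3.Theorems.SahiCTCForms
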